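import Literature.Analysis.SpecialFunctions.GammaStirlingOrder
import Literature.Analysis.Complex.VerticalLineIntegrals
import Mathlib.Analysis.SpecialFunctions.Gamma.Deligne
import HarnessLib

/-!
# Uniform bounds for Gamma ratios `Γ(X + iu)/Γ(Y + iu)` (crude Stirling substitutes)

Topic `Literature/Analysis/SpecialFunctions`, a complement to `GammaVerticalBounds.lean` and
`GammaStirlingOrder.lean`. Everything here is PROVED; there are no named facts and no definitions.

Stirling's formula gives `|Γ(x + iy)| ~ √(2π) |y|^{x − 1/2} e^{−π|y|/2}` (Titchmarsh, *The Theory of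
the Riemann Zeta-Function*, (4.12.2)), whence `|Γ(x + δ + iu)/Γ(x + iu)| ≍ |u|^δ`. Mathlib has no
complex Stirling formula. This file proves elementary two-sided substitutes in which the
exponential factors cancel *exactly* and only the polynomial factors are crude; they are uniform
in the (possibly large, possibly negative) real parts, which is what is needed to let a line of
integration `re s = −k − 1/2` tend to `−∞` in Mellin–Barnes arguments for `L`-functions
(`Literature/NumberTheory/LFunctions/SelbergClassDegreeMellin.lean`):

* `norm_Gamma_shift_ge` — **lower bound** from the log-convexity of
  `x ↦ Γ(x)²/‖Γ(x+iu)‖²` (the tree's `GammaVert.slope_log_gammaRatio_mono`):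
  `‖Γ(x + δ + iu)‖ ≥ (Γ(x+δ)/Γ(x)) (1 + u²/x²)^{δ/2} ‖Γ(x + iu)‖` for `x > 0`, `0 < δ < 1`;
* `norm_Gamma_le_of_mem_Icc` — `‖Γ(x + iu)‖ ≤ 16π² (1 + |u|)^{3/2} e^{−π|u|/2}` for `1 ≤ x ≤ 2` and
  ALL real `u` (the tree's bound for `|u| ≥ 1`, and `Γ ≤ 1` on `[1, 2]`);
* `norm_Gamma_mul_norm_inv_Gamma_le` — **upper bound, uniform in the real parts**: for `X ≥ 1`,
  `Y ≤ 1/2` and all real `u`,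
  `‖Γ(X + iu)‖ · ‖Γ(Y + iu)⁻¹‖ ≤ 120π² (1 + |u|)^{3/2} (X + |Y| + 3 + |u|)^{X − Y + 1/2}`
  (recurrence `Γ(z+1) = zΓ(z)` down to real parts in `[1, 2]`, resp. up to `[1/2, 3/2]`, where the
  tree's `‖Γ‖ ≤ 16π²(1+|u|)^{3/2}e^{−π|u|/2}` and `‖Γ‖ ≥ (2/15)e^{−π|u|/2}` apply; the two exponentials
  cancel);
* `norm_Gamma_neg_half_sub_le` — `‖Γ(−k − 1/2 + it)‖ ≤ √(2π) e^{−π|t|/2} / ∏_{i ≤ k} ‖i + 1/2 + it‖`;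
* `integrable_Gamma_vertical` — `y ↦ Γ(c + iy)` is integrable for `0 < c ≤ 2`.

## References

* E. C. Titchmarsh, *The Theory of the Riemann Zeta-Function*, 2nd ed. (1986), §4.12, (4.12.2)–(4.12.3).
* E. T. Whittaker, G. N. Watson, *A Course of Modern Analysis*, 4th ed., §12.13–§12.14, §13.6.
-/

noncomputable section

open Real Set Complex MeasureTheory

namespace Literature.Analysis.SpecialFunctions

open GammaVert

/-! ### The lower bound for `Γ(x + δ + iu)/Γ(x + iu)` from log-convexity -/

/-- `Γ(x+1)²/‖Γ(x+1+iu)‖² = (x²/(x²+u²)) · Γ(x)²/‖Γ(x+iu)‖²` (`Γ(z+1) = zΓ(z)`), in logarithmic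
form. [folklore] -/
theorem log_gammaRatio_add_one {x : ℝ} (hx : 0 < x) (u : ℝ) :
    Real.log (Real.Gamma (x + 1) ^ 2 / ‖Complex.Gamma ((x + 1 : ℝ) + u * I)‖ ^ 2) -
        Real.log (Real.Gamma x ^ 2 / ‖Complex.Gamma (x + u * I)‖ ^ 2) =
      -Real.log (1 + u ^ 2 / x ^ 2) := by
  have hz : (x : ℂ) + u * I ≠ 0 := by
    intro h0; have := congrArg Complex.re h0; simp at this; linarith
  have hrec : Complex.Gamma ((x + 1 : ℝ) + u * I) = ((x : ℂ) + u * I) * Complex.Gamma (x + u * I) := by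
    have e : (x : ℂ) + u * I + 1 = ((x + 1 : ℝ) : ℂ) + u * I := by push_cast; ring
    rw [← e]; exact Complex.Gamma_add_one _ hz
  have hG : 0 < Real.Gamma x := Real.Gamma_pos_of_pos hx
  have hGc : 0 < ‖Complex.Gamma (x + u * I)‖ := norm_pos_iff.mpr (Gamma_ne_zero_of_pos hx u)
  have hn : ‖(x : ℂ) + u * I‖ ^ 2 = x ^ 2 + u ^ 2 := by
    rw [Complex.sq_norm, Complex.normSq_add_mul_I]
  have hn0 : 0 < x ^ 2 + u ^ 2 := by positivity
  rw [Real.Gamma_add_one hx.ne', hrec, norm_mul, mul_pow, mul_pow, hn,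
    ← Real.log_div (by positivity) (by positivity)]
  rw [← Real.log_inv]
  congr 1
  field_simp

/-- **Lower bound for a Gamma ratio with a real shift `0 < δ < 1`** (log-convexity of
`x ↦ Γ(x)²/‖Γ(x+iu)‖²`, i.e. the slope on `[x, x+δ]` is at most the slope on `[x, x+1]`, which is
`−log(1 + u²/x²)`): `(Γ(x+δ)/Γ(x)) (1 + u²/x²)^{δ/2} ‖Γ(x+iu)‖ ≤ ‖Γ(x+δ+iu)‖` for `x > 0`.
This is the half of Stirling's `|Γ(x+δ+iu)/Γ(x+iu)| ≍ |u|^δ` that survives with elementary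
constants. [folklore] -/
theorem norm_Gamma_shift_ge {x δ : ℝ} (hx : 0 < x) (hδ : 0 < δ) (hδ1 : δ < 1) (u : ℝ) :
    Real.Gamma (x + δ) / Real.Gamma x * (1 + u ^ 2 / x ^ 2) ^ (δ / 2) *
        ‖Complex.Gamma (x + u * I)‖ ≤ ‖Complex.Gamma ((x + δ : ℝ) + u * I)‖ := by
  -- the three values of `φ = log (Γ² / ‖Γ‖²)`
  set A := Real.log (Real.Gamma x ^ 2 / ‖Complex.Gamma (x + u * I)‖ ^ 2) with hA
  set B := Real.log (Real.Gamma (x + δ) ^ 2 / ‖Complex.Gamma ((x + δ : ℝ) + u * I)‖ ^ 2) with hB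
  set C := Real.log (Real.Gamma (x + 1) ^ 2 / ‖Complex.Gamma ((x + 1 : ℝ) + u * I)‖ ^ 2) with hC
  have hslope := slope_log_gammaRatio_mono u hx (by linarith : x < x + δ) (by linarith : x + δ < x + 1)
  rw [← hA, ← hB, ← hC] at hslope
  have h1 : B - A ≤ δ * (C - A) := by
    rw [div_le_div_iff₀ (by linarith) (by linarith)] at hslope
    nlinarith
  rw [hC, hA, log_gammaRatio_add_one hx u, ← hA] at h1
  -- exponentiate
  have hG : 0 < Real.Gamma x := Real.Gamma_pos_of_pos hx
  have hGδ : 0 < Real.Gamma (x + δ) := Real.Gamma_pos_of_pos (by linarith)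
  have hΓ : 0 < ‖Complex.Gamma (x + u * I)‖ := norm_pos_iff.mpr (Gamma_ne_zero_of_pos hx u)
  have hΓδ : 0 < ‖Complex.Gamma ((x + δ : ℝ) + u * I)‖ :=
    norm_pos_iff.mpr (Gamma_ne_zero_of_pos (by linarith) u)
  have hL : 0 < 1 + u ^ 2 / x ^ 2 := by positivity
  have h2 : B ≤ A + δ * -Real.log (1 + u ^ 2 / x ^ 2) := by linarith
  have h3 : Real.exp B ≤ Real.exp A * (1 + u ^ 2 / x ^ 2) ^ (-δ) := by
    calc Real.exp B ≤ Real.exp (A + δ * -Real.log (1 + u ^ 2 / x ^ 2)) := Real.exp_le_exp.2 h2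
      _ = Real.exp A * (1 + u ^ 2 / x ^ 2) ^ (-δ) := by
          rw [Real.exp_add, Real.rpow_def_of_pos hL]; ring_nf
  rw [hB, hA, Real.exp_log (by positivity), Real.exp_log (by positivity)] at h3
  -- `h3 : Γ(x+δ)²/‖Γδ‖² ≤ Γ(x)²/‖Γ‖² · L^{-δ}`; rearrange
  have h4 : Real.Gamma (x + δ) ^ 2 * ‖Complex.Gamma (x + u * I)‖ ^ 2 * (1 + u ^ 2 / x ^ 2) ^ δ ≤
      Real.Gamma x ^ 2 * ‖Complex.Gamma ((x + δ : ℝ) + u * I)‖ ^ 2 := by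
    rw [div_le_iff₀ (by positivity)] at h3
    have e : Real.Gamma x ^ 2 / ‖Complex.Gamma (x + u * I)‖ ^ 2 * (1 + u ^ 2 / x ^ 2) ^ (-δ) *
        ‖Complex.Gamma ((x + δ : ℝ) + u * I)‖ ^ 2 * (‖Complex.Gamma (x + u * I)‖ ^ 2 *
          (1 + u ^ 2 / x ^ 2) ^ δ) = Real.Gamma x ^ 2 * ‖Complex.Gamma ((x + δ : ℝ) + u * I)‖ ^ 2 := by
      rw [Real.rpow_neg hL.le]
      field_simp
    calc Real.Gamma (x + δ) ^ 2 * ‖Complex.Gamma (x + u * I)‖ ^ 2 * (1 + u ^ 2 / x ^ 2) ^ δ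
        = Real.Gamma (x + δ) ^ 2 * (‖Complex.Gamma (x + u * I)‖ ^ 2 * (1 + u ^ 2 / x ^ 2) ^ δ) := by
          ring
      _ ≤ Real.Gamma x ^ 2 / ‖Complex.Gamma (x + u * I)‖ ^ 2 * (1 + u ^ 2 / x ^ 2) ^ (-δ) *
          ‖Complex.Gamma ((x + δ : ℝ) + u * I)‖ ^ 2 * (‖Complex.Gamma (x + u * I)‖ ^ 2 *
          (1 + u ^ 2 / x ^ 2) ^ δ) := mul_le_mul_of_nonneg_right h3 (by positivity)
      _ = _ := e
  -- take square roots
  have h5 : (Real.Gamma (x + δ) * ‖Complex.Gamma (x + u * I)‖ * (1 + u ^ 2 / x ^ 2) ^ (δ / 2)) ^ 2 ≤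
      (Real.Gamma x * ‖Complex.Gamma ((x + δ : ℝ) + u * I)‖) ^ 2 := by
    have e : ((1 + u ^ 2 / x ^ 2) ^ (δ / 2)) ^ 2 = (1 + u ^ 2 / x ^ 2) ^ δ := by
      rw [← Real.rpow_natCast, ← Real.rpow_mul hL.le]; norm_num
    calc _ = Real.Gamma (x + δ) ^ 2 * ‖Complex.Gamma (x + u * I)‖ ^ 2 * (1 + u ^ 2 / x ^ 2) ^ δ := by
          rw [mul_pow, mul_pow, e]
      _ ≤ Real.Gamma x ^ 2 * ‖Complex.Gamma ((x + δ : ℝ) + u * I)‖ ^ 2 := h4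
      _ = _ := by ring
  rw [sq_le_sq] at h5
  have h7 := h5
  rw [abs_of_nonneg (by positivity), abs_of_nonneg (by positivity)] at h7
  rw [div_mul_eq_mul_div, div_mul_eq_mul_div, div_le_iff₀ hG]
  calc Real.Gamma (x + δ) * (1 + u ^ 2 / x ^ 2) ^ (δ / 2) * ‖Complex.Gamma (x + u * I)‖
      = Real.Gamma (x + δ) * ‖Complex.Gamma (x + u * I)‖ * (1 + u ^ 2 / x ^ 2) ^ (δ / 2) := by ring
    _ ≤ Real.Gamma x * ‖Complex.Gamma ((x + δ : ℝ) + u * I)‖ := h7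
    _ = ‖Complex.Gamma ((x + δ : ℝ) + u * I)‖ * Real.Gamma x := by ring

/-! ### Recurrence: moving the real part by an integer -/

/-- `Γ(z)⁻¹ = (∏_{k<m} (z + k)) · Γ(z + m)⁻¹`, the iterated form of Mathlib's
`one_div_Gamma_eq_self_mul_one_div_Gamma_add_one` (valid at the poles too). [folklore] -/
theorem inv_Gamma_eq_prod_mul_inv_Gamma_add_nat (z : ℂ) (m : ℕ) :
    (Complex.Gamma z)⁻¹ = (∏ k ∈ Finset.range m, (z + k)) * (Complex.Gamma (z + m))⁻¹ := by
  induction m with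
  | zero => simp
  | succ m ih =>
    rw [ih, Finset.prod_range_succ, Complex.one_div_Gamma_eq_self_mul_one_div_Gamma_add_one (z + m),
      show z + (m : ℂ) + 1 = z + ((m + 1 : ℕ) : ℂ) by push_cast; ring]
    ring

/-- `Γ(z + m) = (∏_{k<m} (z + k)) · Γ(z)` for `re z > 0` (no poles are met). [folklore] -/
theorem Gamma_add_nat_eq_prod_mul {z : ℂ} (hz : 0 < z.re) (m : ℕ) :
    Complex.Gamma (z + m) = (∏ k ∈ Finset.range m, (z + k)) * Complex.Gamma z := by
  induction m with
  | zero => simp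
  | succ m ih =>
    have hne : z + (m : ℂ) ≠ 0 := by
      intro h0; have := congrArg Complex.re h0; simp at this; linarith
    rw [show z + ((m + 1 : ℕ) : ℂ) = z + (m : ℂ) + 1 by push_cast; ring,
      Complex.Gamma_add_one _ hne, ih, Finset.prod_range_succ]
    ring

/-- `‖x + k + iu‖ ≤ |x + k| + |u|`. [folklore] -/
theorem norm_ofReal_add_nat_add_mul_I_le (x u : ℝ) (k : ℕ) :
    ‖(x : ℂ) + u * I + k‖ ≤ |x + k| + |u| := by
  have e : (x : ℂ) + u * I + k = ((x + k : ℝ) : ℂ) + u * I := by push_cast; ring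
  rw [e]
  refine (Complex.norm_le_abs_re_add_abs_im _).trans (le_of_eq ?_)
  simp

/-! ### `‖Γ(x + iu)‖ ≤ 16π² (1 + |u|)^{3/2} e^{−π|u|/2}` for `1 ≤ x ≤ 2`, all `u` -/

/-- `16 π² e^{−π/2} ≥ 1` (indeed `> 16`, from `π > 3`, `π < 4`, `e < 3`). [folklore] -/
theorem one_le_sixteen_pi_sq_mul_exp : (1 : ℝ) ≤ 16 * π ^ 2 * Real.exp (-(π * 1) / 2) := by
  have hπ3 := Real.pi_gt_three
  have hπ4 := Real.pi_lt_four
  have he : Real.exp (-(π * 1) / 2) ≥ Real.exp (-2) := Real.exp_le_exp.2 (by linarith)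
  have he2 : Real.exp (-2) * Real.exp 2 = 1 := by rw [← Real.exp_add]; norm_num
  have he1 : Real.exp 2 < 9 := by
    have := Real.exp_one_lt_d9
    have e : Real.exp 2 = Real.exp 1 * Real.exp 1 := by rw [← Real.exp_add]; norm_num
    rw [e]; nlinarith [Real.exp_pos 1]
  have hexp2 : 1 / 9 ≤ Real.exp (-2) := by
    rw [div_le_iff₀ (by norm_num : (0:ℝ) < 9)]
    nlinarith [Real.exp_pos (-2)]
  nlinarith

/-- **`‖Γ(x + iu)‖ ≤ 16π² (1 + |u|)^{3/2} e^{−π|u|/2}` for `1 ≤ x ≤ 2` and all real `u`**: for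
`|u| ≥ 1` this is the tree's `norm_Gamma_le_exp_of_le_two`; for `|u| < 1`,
`‖Γ(x+iu)‖ ≤ Γ(x) ≤ 1 ≤ 16π²e^{−π/2}`. [folklore] -/
theorem norm_Gamma_le_of_mem_Icc {x : ℝ} (h1 : 1 ≤ x) (h2 : x ≤ 2) (u : ℝ) :
    ‖Complex.Gamma (x + u * I)‖ ≤
      16 * π ^ 2 * (1 + |u|) ^ (3 / 2 : ℝ) * Real.exp (-(π * |u|) / 2) := by
  rcases le_or_gt 1 |u| with hu | hu
  · exact norm_Gamma_le_exp_of_le_two (by linarith) h2 hu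
  · -- `Γ(x) ≤ 1` on `[1, 2]` (convexity, `Γ(1) = Γ(2) = 1`; also in the tree as
    -- `Literature.NumberTheory.LFunctions.Real.Gamma_le_one_of_mem_Icc`, not imported here)
    have hG1 : Real.Gamma x ≤ 1 := by
      have hseg : x ∈ segment ℝ (1 : ℝ) 2 := by
        rw [segment_eq_Icc (by norm_num)]; exact ⟨h1, h2⟩
      have h := Real.convexOn_Gamma.le_on_segment (by norm_num : (1 : ℝ) ∈ Ioi 0)
        (by norm_num : (2 : ℝ) ∈ Ioi 0) hseg
      rwa [Real.Gamma_one, Real.Gamma_two, max_self] at h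
    have hG : ‖Complex.Gamma (x + u * I)‖ ≤ 1 := (norm_Gamma_le_Gamma_re (by linarith) u).trans hG1
    refine hG.trans ?_
    have hb : (1 : ℝ) ≤ (1 + |u|) ^ (3 / 2 : ℝ) :=
      Real.one_le_rpow (by linarith [abs_nonneg u]) (by norm_num)
    have he : Real.exp (-(π * 1) / 2) ≤ Real.exp (-(π * |u|) / 2) :=
      Real.exp_le_exp.2 (by nlinarith [Real.pi_pos, abs_nonneg u])
    calc (1 : ℝ) ≤ 16 * π ^ 2 * Real.exp (-(π * 1) / 2) := one_le_sixteen_pi_sq_mul_exp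
      _ = 16 * π ^ 2 * 1 * Real.exp (-(π * 1) / 2) := by ring
      _ ≤ 16 * π ^ 2 * (1 + |u|) ^ (3 / 2 : ℝ) * Real.exp (-(π * |u|) / 2) := by
          gcongr

/-- Recurrence form of the upper bound: for `1 ≤ x ≤ 2`, `n ∈ ℕ` and all real `u`,
`‖Γ(x + n + iu)‖ ≤ 16π² (1+|u|)^{3/2} e^{−π|u|/2} ∏_{k<n} (x + k + |u|)`. [folklore] -/
theorem norm_Gamma_add_nat_le {x : ℝ} (h1 : 1 ≤ x) (h2 : x ≤ 2) (n : ℕ) (u : ℝ) :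
    ‖Complex.Gamma ((x + n : ℝ) + u * I)‖ ≤
      16 * π ^ 2 * (1 + |u|) ^ (3 / 2 : ℝ) * Real.exp (-(π * |u|) / 2) *
        ∏ k ∈ Finset.range n, (x + k + |u|) := by
  have hz : 0 < ((x : ℂ) + u * I).re := by simp; linarith
  have e : ((x + n : ℝ) : ℂ) + u * I = (x : ℂ) + u * I + n := by push_cast; ring
  rw [e, Gamma_add_nat_eq_prod_mul hz n, norm_mul, norm_prod, mul_comm]
  refine mul_le_mul (norm_Gamma_le_of_mem_Icc h1 h2 u) ?_ (by positivity) (by positivity)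
  refine Finset.prod_le_prod (fun k _ ↦ norm_nonneg _) fun k _ ↦ ?_
  refine (norm_ofReal_add_nat_add_mul_I_le x u k).trans (le_of_eq ?_)
  rw [abs_of_nonneg (by positivity)]

/-- Recurrence form of the lower bound, for the reciprocal: for `1/2 ≤ y ≤ 5/2`, `n ∈ ℕ` and all
real `u`, `‖Γ(y − n + iu)⁻¹‖ ≤ (15/2) e^{π|u|/2} ∏_{k<n} (|y − n + k| + |u|)` (the tree's
`‖Γ(y+iu)‖ ≥ (2/15)e^{−π|u|/2}` and `Γ(z)⁻¹ = ∏_{k<n}(z+k) Γ(z+n)⁻¹`). [folklore] -/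
theorem norm_inv_Gamma_sub_nat_le {y : ℝ} (h1 : 1 / 2 ≤ y) (h2 : y ≤ 5 / 2) (n : ℕ) (u : ℝ) :
    ‖(Complex.Gamma ((y - n : ℝ) + u * I))⁻¹‖ ≤
      15 / 2 * Real.exp (π * |u| / 2) * ∏ k ∈ Finset.range n, (|y - n + k| + |u|) := by
  have hlow := norm_Gamma_ge_exp h1 h2 u
  have hE := Real.exp_pos (-(π * |u|) / 2)
  have hpos : 0 < ‖Complex.Gamma (y + u * I)‖ := lt_of_lt_of_le (by positivity) hlow
  have e : ((y - n : ℝ) : ℂ) + u * I + n = (y : ℂ) + u * I := by push_cast; ring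
  rw [inv_Gamma_eq_prod_mul_inv_Gamma_add_nat _ n, e, norm_mul, norm_prod, norm_inv, mul_comm]
  refine mul_le_mul ?_ ?_ (by positivity) (by positivity)
  · rw [inv_le_iff_one_le_mul₀ hpos]
    calc (1 : ℝ) = 15 / 2 * Real.exp (π * |u| / 2) * (2 / 15 * Real.exp (-(π * |u|) / 2)) := by
          rw [show -(π * |u|) / 2 = -(π * |u| / 2) by ring, Real.exp_neg]; field_simp
      _ ≤ 15 / 2 * Real.exp (π * |u| / 2) * ‖Complex.Gamma (y + u * I)‖ := by gcongr
  · refine Finset.prod_le_prod (fun k _ ↦ norm_nonneg _) fun k _ ↦ ?_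
    exact norm_ofReal_add_nat_add_mul_I_le (y - n) u k

/-! ### The uniform upper bound for `‖Γ(X + iu)‖ · ‖Γ(Y + iu)⁻¹‖` -/

/-- **Upper bound for a Gamma ratio, uniform in the real parts.** For `X ≥ 1`, `Y ≤ 1/2` and all
real `u`: `‖Γ(X + iu)‖ · ‖Γ(Y + iu)⁻¹‖ ≤ 120π² (1 + |u|)^{3/2} (X + |Y| + 3 + |u|)^{X − Y + 1/2}`.
Write `X = x + n'` with `x ∈ [1, 2)` and `Y = y − n` with `y ∈ [1/2, 3/2)`; the recurrence bounds
`norm_Gamma_add_nat_le`, `norm_inv_Gamma_sub_nat_le` have `n' + n ≤ X − Y + 1/2` linear factors,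
each at most `X + |Y| + 3 + |u|`, and the factors `e^{∓π|u|/2}` cancel. (Stirling would give the
exponent `X − Y` exactly; the loss `1/2 + 3/2` in the exponent is harmless when the bound is used
with `X − Y → ∞`.) [folklore] -/
theorem norm_Gamma_mul_norm_inv_Gamma_le {X Y : ℝ} (hX : 1 ≤ X) (hY : Y ≤ 1 / 2) (u : ℝ) :
    ‖Complex.Gamma (X + u * I)‖ * ‖(Complex.Gamma (Y + u * I))⁻¹‖ ≤
      120 * π ^ 2 * (1 + |u|) ^ (3 / 2 : ℝ) * (X + |Y| + 3 + |u|) ^ (X - Y + 1 / 2) := by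
  -- `X = x + n'`, `x ∈ [1,2)`
  set n' : ℕ := ⌊X⌋₊ - 1 with hn'
  have hfl1 : 1 ≤ ⌊X⌋₊ := Nat.le_floor (by exact_mod_cast hX)
  have hn'R : (n' : ℝ) = ⌊X⌋₊ - 1 := by
    rw [hn', Nat.cast_sub hfl1, Nat.cast_one]
  set x : ℝ := X - n' with hx
  have hx1 : 1 ≤ x := by
    have := Nat.floor_le (by linarith : (0 : ℝ) ≤ X); rw [hx, hn'R]; linarith
  have hx2 : x ≤ 2 := by
    have := Nat.lt_floor_add_one X; rw [hx, hn'R]; linarith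
  have hX' : X = x + n' := by rw [hx]; ring
  -- `Y = y - n`, `y ∈ [1/2, 3/2)`
  set n : ℕ := ⌈1 / 2 - Y⌉₊ with hn
  set y : ℝ := Y + n with hy
  have hy1 : 1 / 2 ≤ y := by
    have := Nat.le_ceil (1 / 2 - Y); rw [hy]; linarith
  have hy2 : y < 3 / 2 := by
    have := Nat.ceil_lt_add_one (by linarith : (0 : ℝ) ≤ 1 / 2 - Y); rw [hy]; linarith
  have hY' : Y = y - n := by rw [hy]; ring
  -- the two recurrence bounds
  have hup := norm_Gamma_add_nat_le hx1 hx2 n' u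
  have hdn := norm_inv_Gamma_sub_nat_le hy1 (by linarith) n u
  rw [← hX'] at hup
  rw [← hY'] at hdn
  -- each linear factor is at most `W + |u|`
  set W : ℝ := X + |Y| + 3 with hW
  have hW1 : 1 ≤ W + |u| := by
    have := abs_nonneg Y; have := abs_nonneg u; rw [hW]; linarith
  have hW0 : 0 ≤ W + |u| := by linarith
  have hfac1 : ∀ k ∈ Finset.range n', x + k + |u| ≤ W + |u| := by
    intro k hk
    have hk' : (k : ℝ) + 1 ≤ n' := by exact_mod_cast Finset.mem_range.1 hk
    have := abs_nonneg Y
    rw [hW, hX']; linarith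
  have hfac2 : ∀ k ∈ Finset.range n, |Y + k| + |u| ≤ W + |u| := by
    intro k hk
    have hk' : (k : ℝ) + 1 ≤ n := by exact_mod_cast Finset.mem_range.1 hk
    have hk0 : (0 : ℝ) ≤ k := Nat.cast_nonneg k
    have h3 : |Y + k| ≤ |Y| + 3 / 2 := by
      rw [abs_le]
      constructor
      · linarith [neg_abs_le Y]
      · linarith [le_abs_self Y, abs_nonneg Y]
    rw [hW]; linarith
  have hprod1 : ∏ k ∈ Finset.range n', (x + k + |u|) ≤ (W + |u|) ^ n' :=
    calc ∏ k ∈ Finset.range n', (x + k + |u|) ≤ ∏ _k ∈ Finset.range n', (W + |u|) :=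
          Finset.prod_le_prod (fun k _ ↦ by positivity) hfac1
      _ = (W + |u|) ^ n' := by rw [Finset.prod_const, Finset.card_range]
  have hprod2 : ∏ k ∈ Finset.range n, (|Y + k| + |u|) ≤ (W + |u|) ^ n :=
    calc ∏ k ∈ Finset.range n, (|Y + k| + |u|) ≤ ∏ _k ∈ Finset.range n, (W + |u|) :=
          Finset.prod_le_prod (fun k _ ↦ by positivity) hfac2
      _ = (W + |u|) ^ n := by rw [Finset.prod_const, Finset.card_range]
  -- number of factors
  have hcount : ((n' + n : ℕ) : ℝ) ≤ X - Y + 1 / 2 := by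
    push_cast
    have e1 : (n' : ℝ) = X - x := by rw [hX']; ring
    have e2 : (n : ℝ) = y - Y := by rw [hY']; ring
    rw [e1, e2]; linarith
  have hpow : (W + |u|) ^ n' * (W + |u|) ^ n ≤ (W + |u|) ^ (X - Y + 1 / 2) := by
    rw [← pow_add, ← Real.rpow_natCast]
    exact Real.rpow_le_rpow_of_exponent_le hW1 hcount
  -- assemble
  have hE : Real.exp (-(π * |u|) / 2) * Real.exp (π * |u| / 2) = 1 := by
    rw [← Real.exp_add]; convert Real.exp_zero using 2; ring
  calc ‖Complex.Gamma (X + u * I)‖ * ‖(Complex.Gamma (Y + u * I))⁻¹‖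
      ≤ (16 * π ^ 2 * (1 + |u|) ^ (3 / 2 : ℝ) * Real.exp (-(π * |u|) / 2) *
          ∏ k ∈ Finset.range n', (x + k + |u|)) *
        (15 / 2 * Real.exp (π * |u| / 2) * ∏ k ∈ Finset.range n, (|Y + k| + |u|)) :=
        mul_le_mul hup hdn (by positivity) (by positivity)
    _ ≤ (16 * π ^ 2 * (1 + |u|) ^ (3 / 2 : ℝ) * Real.exp (-(π * |u|) / 2) * (W + |u|) ^ n') *
        (15 / 2 * Real.exp (π * |u| / 2) * (W + |u|) ^ n) := by
        gcongr
    _ = 120 * π ^ 2 * (1 + |u|) ^ (3 / 2 : ℝ) *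
        (Real.exp (-(π * |u|) / 2) * Real.exp (π * |u| / 2)) * ((W + |u|) ^ n' * (W + |u|) ^ n) := by
        ring
    _ ≤ 120 * π ^ 2 * (1 + |u|) ^ (3 / 2 : ℝ) * 1 * (W + |u|) ^ (X - Y + 1 / 2) := by
        rw [hE]; gcongr
    _ = 120 * π ^ 2 * (1 + |u|) ^ (3 / 2 : ℝ) * (X + |Y| + 3 + |u|) ^ (X - Y + 1 / 2) := by
        rw [hW, mul_one]

/-! ### `Γ` on the lines `re s = 1/2` and `re s = −k − 1/2` -/

/-- `‖Γ(1/2 + it)‖ ≤ √(2π) e^{−π|t|/2}` (from `|Γ(1/2+it)|² = π/cosh πt`). [folklore] -/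
theorem norm_Gamma_half_le (t : ℝ) :
    ‖Complex.Gamma (1 / 2 + t * I)‖ ≤ Real.sqrt (2 * π) * Real.exp (-(π * |t|) / 2) := by
  have hsq := norm_sq_Gamma_half t
  have hc : 0 < Real.cosh (π * t) := Real.cosh_pos _
  have h2 : ‖Complex.Gamma (1 / 2 + t * I)‖ ^ 2 ≤ (Real.sqrt (2 * π) * Real.exp (-(π * |t|) / 2)) ^ 2 := by
    rw [hsq, mul_pow, Real.sq_sqrt (by positivity), ← Real.exp_nat_mul, div_le_iff₀ hc]
    -- `e^{|x|} ≤ 2 cosh x`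
    have h3 : Real.exp |π * t| ≤ 2 * Real.cosh (π * t) := by
      rw [Real.cosh_eq]
      rcases le_or_gt 0 (π * t) with h | h
      · rw [abs_of_nonneg h]; linarith [Real.exp_pos (-(π * t))]
      · rw [abs_of_neg h]; linarith [Real.exp_pos (π * t)]
    rw [abs_mul, abs_of_pos Real.pi_pos] at h3
    have e : Real.exp ((2 : ℕ) * (-(π * |t|) / 2)) * Real.exp (π * |t|) = 1 := by
      rw [← Real.exp_add]; convert Real.exp_zero using 2; push_cast; ring
    calc π = π * (Real.exp ((2 : ℕ) * (-(π * |t|) / 2)) * Real.exp (π * |t|)) := by rw [e, mul_one]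
      _ ≤ π * (Real.exp ((2 : ℕ) * (-(π * |t|) / 2)) * (2 * Real.cosh (π * t))) := by gcongr
      _ = 2 * π * Real.exp ((2 : ℕ) * (-(π * |t|) / 2)) * Real.cosh (π * t) := by ring
  exact (pow_le_pow_iff_left₀ (norm_nonneg _) (by positivity) two_ne_zero).1 h2

/-- On the line `re s = −k − 1/2` (`k ∈ ℕ`): with `z = −k − 1/2 + it`,
`‖Γ(z)‖ · ∏_{i ≤ k} ‖z + i‖ = ‖Γ(1/2 + it)‖` (`Γ(z)⁻¹ = ∏_{i≤k}(z+i) · Γ(z+k+1)⁻¹` and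
`z + k + 1 = 1/2 + it`). [folklore] -/
theorem norm_Gamma_neg_half_sub_nat_mul_prod (k : ℕ) (t : ℝ) :
    ‖Complex.Gamma (((-(k : ℝ) - 1 / 2 : ℝ) : ℂ) + t * I)‖ *
        ∏ i ∈ Finset.range (k + 1), ‖((-(k : ℝ) - 1 / 2 : ℝ) : ℂ) + t * I + i‖ =
      ‖Complex.Gamma (1 / 2 + t * I)‖ := by
  set z : ℂ := ((-(k : ℝ) - 1 / 2 : ℝ) : ℂ) + t * I with hz
  have hzk : z + ((k + 1 : ℕ) : ℂ) = 1 / 2 + t * I := by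
    rw [hz]; push_cast; ring
  have hid := inv_Gamma_eq_prod_mul_inv_Gamma_add_nat z (k + 1)
  rw [hzk] at hid
  have hΓ : Complex.Gamma (1 / 2 + t * I) ≠ 0 := by
    have := Gamma_ne_zero_of_pos (by norm_num : (0 : ℝ) < 1 / 2) t
    simpa using this
  have hP : ∏ i ∈ Finset.range (k + 1), (z + i) ≠ 0 := by
    refine Finset.prod_ne_zero_iff.2 fun i hi h0 ↦ ?_
    have hre := congrArg Complex.re h0
    simp [hz] at hre
    have hi' : i ≤ k := Nat.lt_succ_iff.1 (Finset.mem_range.1 hi)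
    have : (i : ℝ) ≤ k := by exact_mod_cast hi'
    linarith
  have h2 : Complex.Gamma (1 / 2 + t * I) = (∏ i ∈ Finset.range (k + 1), (z + i)) * Complex.Gamma z := by
    have h := congrArg Inv.inv hid
    rw [inv_inv, mul_inv, inv_inv] at h
    rw [h]; field_simp
  rw [h2, norm_mul, norm_prod, mul_comm]

/-- The factors on the line `re s = −k − 1/2`, reflected: `‖(−k − 1/2 + it) + (k − j)‖² = (j + 1/2)² + t²`
for `j ≤ k`; in product form `∏_{i ≤ k} ‖z + i‖ = ∏_{j ≤ k} √((j + 1/2)² + t²)`. [folklore] -/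
theorem prod_norm_neg_half_sub_nat_add (k : ℕ) (t : ℝ) :
    ∏ i ∈ Finset.range (k + 1), ‖((-(k : ℝ) - 1 / 2 : ℝ) : ℂ) + t * I + i‖ =
      ∏ j ∈ Finset.range (k + 1), Real.sqrt ((j + 1 / 2) ^ 2 + t ^ 2) := by
  rw [← Finset.prod_range_reflect _ (k + 1)]
  refine Finset.prod_congr rfl fun j hj ↦ ?_
  have hj' : j ≤ k := Nat.lt_succ_iff.1 (Finset.mem_range.1 hj)
  have e : ((-(k : ℝ) - 1 / 2 : ℝ) : ℂ) + t * I + ((k + 1 - 1 - j : ℕ) : ℂ) =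
      ((-(j : ℝ) - 1 / 2 : ℝ) : ℂ) + t * I := by
    rw [show k + 1 - 1 - j = k - j from by omega, Nat.cast_sub hj']
    push_cast; ring
  rw [e, Complex.norm_def, Complex.normSq_add_mul_I]
  congr 1; ring

/-- **`‖Γ(−k − 1/2 + it)‖ ≤ √(2π) e^{−π|t|/2} / ∏_{j ≤ k} √((j + 1/2)² + t²)`.** [folklore] -/
theorem norm_Gamma_neg_half_sub_nat_le (k : ℕ) (t : ℝ) :
    ‖Complex.Gamma (((-(k : ℝ) - 1 / 2 : ℝ) : ℂ) + t * I)‖ ≤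
      Real.sqrt (2 * π) * Real.exp (-(π * |t|) / 2) /
        ∏ j ∈ Finset.range (k + 1), Real.sqrt ((j + 1 / 2) ^ 2 + t ^ 2) := by
  have h := norm_Gamma_neg_half_sub_nat_mul_prod k t
  rw [prod_norm_neg_half_sub_nat_add] at h
  have hP : 0 < ∏ j ∈ Finset.range (k + 1), Real.sqrt ((j + 1 / 2) ^ 2 + t ^ 2) :=
    Finset.prod_pos fun j _ ↦ Real.sqrt_pos.2 (by positivity)
  rw [le_div_iff₀ hP, h]
  exact norm_Gamma_half_le t

/-- A lower bound for the product on the line `re s = −k − 1/2`: for `q ≤ k + 1`,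
`∏_{j ≤ k} √((j + 1/2)² + t²) ≥ q! (q + |t|)^{k+1−q} / 2^{k+1}` (for `j < q` use
`√(…) ≥ j + 1/2 ≥ (j+1)/2`, for `j ≥ q` use `√(a² + t²) ≥ (a + |t|)/2 ≥ (q + |t|)/2`). [folklore] -/
theorem factorial_mul_pow_le_prod_sqrt {k q : ℕ} (hq : q ≤ k + 1) (t : ℝ) :
    (q.factorial : ℝ) * (q + |t|) ^ (k + 1 - q) / 2 ^ (k + 1) ≤
      ∏ j ∈ Finset.range (k + 1), Real.sqrt ((j + 1 / 2) ^ 2 + t ^ 2) := by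
  have hsqrt : ∀ (a : ℝ), 0 ≤ a → (a + |t|) / 2 ≤ Real.sqrt (a ^ 2 + t ^ 2) := by
    intro a ha
    rw [Real.le_sqrt (by positivity) (by positivity)]
    nlinarith [sq_abs t, sq_nonneg (a - |t|), abs_nonneg t]
  -- split the range at `q`
  rw [← Finset.prod_range_mul_prod_Ico _ hq]
  have h1 : (q.factorial : ℝ) / 2 ^ q ≤ ∏ j ∈ Finset.range q, Real.sqrt ((j + 1 / 2) ^ 2 + t ^ 2) := by
    have e : (q.factorial : ℝ) / 2 ^ q = ∏ j ∈ Finset.range q, ((j + 1 : ℝ) / 2) := by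
      rw [Finset.prod_div_distrib, Finset.prod_const, Finset.card_range,
        ← Finset.prod_range_add_one_eq_factorial]
      push_cast; rfl
    rw [e]
    refine Finset.prod_le_prod (fun j _ ↦ by positivity) fun j _ ↦ ?_
    calc ((j : ℝ) + 1) / 2 ≤ (j : ℝ) + 1 / 2 := by linarith [(Nat.cast_nonneg j : (0 : ℝ) ≤ j)]
      _ ≤ Real.sqrt (((j : ℝ) + 1 / 2) ^ 2 + t ^ 2) :=
          (Real.le_sqrt (by positivity) (by positivity)).2 (by nlinarith [sq_nonneg t])
  have h2 : ((q : ℝ) + |t|) ^ (k + 1 - q) / 2 ^ (k + 1 - q) ≤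
      ∏ j ∈ Finset.Ico q (k + 1), Real.sqrt ((j + 1 / 2) ^ 2 + t ^ 2) := by
    have e : ((q : ℝ) + |t|) ^ (k + 1 - q) / 2 ^ (k + 1 - q) =
        ∏ _j ∈ Finset.Ico q (k + 1), (((q : ℝ) + |t|) / 2) := by
      rw [Finset.prod_const, Nat.card_Ico, div_pow]
    rw [e]
    refine Finset.prod_le_prod (fun j _ ↦ by positivity) fun j hj ↦ ?_
    have hj' : (q : ℝ) ≤ j := by exact_mod_cast (Finset.mem_Ico.1 hj).1
    calc ((q : ℝ) + |t|) / 2 ≤ ((j : ℝ) + 1 / 2 + |t|) / 2 := by linarith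
      _ ≤ Real.sqrt (((j : ℝ) + 1 / 2) ^ 2 + t ^ 2) := hsqrt _ (by positivity)
  have hq0 : (0 : ℝ) ≤ (q.factorial : ℝ) / 2 ^ q := by positivity
  have hp0 : (0 : ℝ) ≤ ((q : ℝ) + |t|) ^ (k + 1 - q) / 2 ^ (k + 1 - q) := by positivity
  calc (q.factorial : ℝ) * (q + |t|) ^ (k + 1 - q) / 2 ^ (k + 1)
      = (q.factorial : ℝ) / 2 ^ q * (((q : ℝ) + |t|) ^ (k + 1 - q) / 2 ^ (k + 1 - q)) := by
        rw [show k + 1 = q + (k + 1 - q) from by omega, pow_add,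
          show q + (k + 1 - q) - q = k + 1 - q from by omega]
        field_simp
    _ ≤ _ := mul_le_mul h1 h2 hp0 (hq0.trans h1)

/-! ### Integrability along vertical lines -/

/-- `(1 + |t|)^p e^{−a|t|}` is integrable on `ℝ` for `a > 0`, `p ≥ 0`. [folklore] -/
theorem integrable_one_add_abs_rpow_mul_exp_neg {a p : ℝ} (ha : 0 < a) (hp : 0 ≤ p) :
    Integrable fun t : ℝ ↦ (1 + |t|) ^ p * Real.exp (-(a * |t|)) := by
  have hcont : Continuous fun t : ℝ ↦ (1 + |t|) ^ p * Real.exp (-(a * |t|)) := by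
    refine (Continuous.rpow_const (by fun_prop) fun t ↦ Or.inr hp).mul (by fun_prop)
  set N : ℕ := ⌈p⌉₊ + 2 with hN
  refine Complex.VLI.integrable_of_continuous_of_norm_le hcont
    (C := Real.exp a * N.factorial / a ^ N) (R := 0) fun t _ ↦ ?_
  have ht : 0 ≤ |t| := abs_nonneg t
  have hb : 1 ≤ 1 + |t| := by linarith
  rw [Real.norm_of_nonneg (by positivity)]
  -- `(1+|t|)^p (1+t²) ≤ (1+|t|)^N`
  have hpN : (1 + |t|) ^ p * (1 + t ^ 2) ≤ (1 + |t|) ^ (N : ℝ) := by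
    have h1 : (1 + |t|) ^ p ≤ (1 + |t|) ^ (⌈p⌉₊ : ℝ) :=
      Real.rpow_le_rpow_of_exponent_le hb (Nat.le_ceil p)
    have h2 : 1 + t ^ 2 ≤ (1 + |t|) ^ (2 : ℝ) := by
      rw [show ((2 : ℝ)) = ((2 : ℕ) : ℝ) by norm_num, Real.rpow_natCast]
      nlinarith [sq_abs t]
    calc (1 + |t|) ^ p * (1 + t ^ 2) ≤ (1 + |t|) ^ (⌈p⌉₊ : ℝ) * (1 + |t|) ^ (2 : ℝ) :=
          mul_le_mul h1 h2 (by positivity) (by positivity)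
      _ = (1 + |t|) ^ (N : ℝ) := by
          rw [← Real.rpow_add (by positivity), hN]; push_cast; ring_nf
  -- `(a(1+|t|))^N / N! ≤ e^{a(1+|t|)}`
  have hexp := Real.pow_div_factorial_le_exp (a * (1 + |t|)) (by positivity) N
  have hNf : (0 : ℝ) < N.factorial := by positivity
  have haN : 0 < a ^ N := by positivity
  rw [div_le_iff₀ hNf, mul_pow] at hexp
  -- assemble: `(1+|t|)^p e^{-a|t|} ≤ C (1+t²)⁻¹`
  have hsq : 0 < 1 + t ^ 2 := by positivity
  rw [le_mul_inv_iff₀ hsq]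
  calc (1 + |t|) ^ p * Real.exp (-(a * |t|)) * (1 + t ^ 2)
      = (1 + |t|) ^ p * (1 + t ^ 2) * Real.exp (-(a * |t|)) := by ring
    _ ≤ (1 + |t|) ^ (N : ℝ) * Real.exp (-(a * |t|)) := by gcongr
    _ = (a ^ N * (1 + |t|) ^ N) * (Real.exp (-(a * |t|)) / a ^ N) := by
        rw [Real.rpow_natCast]; field_simp
    _ ≤ (Real.exp (a * (1 + |t|)) * N.factorial) * (Real.exp (-(a * |t|)) / a ^ N) := by gcongr
    _ = Real.exp a * N.factorial / a ^ N := by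
        rw [show a * (1 + |t|) = a + a * |t| by ring, Real.exp_add]
        field_simp
        rw [← Real.exp_add]; simp

/-- `e^{−a|t|}` is integrable on `ℝ` for `a > 0`. [folklore] -/
theorem integrable_exp_neg_mul_abs {a : ℝ} (ha : 0 < a) :
    Integrable fun t : ℝ ↦ Real.exp (-(a * |t|)) := by
  have h := integrable_one_add_abs_rpow_mul_exp_neg ha le_rfl
  refine h.congr (Filter.Eventually.of_forall fun t ↦ ?_)
  simp [Real.rpow_zero]

/-- **`y ↦ Γ(c + iy)` is integrable on `ℝ` for `0 < c ≤ 2`** (continuity, and the bound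
`‖Γ(c+iy)‖ ≤ 16π²(1+|y|)^{3/2}e^{−π|y|/2}` for `|y| ≥ 1`, `≤ Γ(c)` for `|y| < 1`). [folklore] -/
theorem integrable_Gamma_vertical {c : ℝ} (hc : 0 < c) (hc2 : c ≤ 2) :
    Integrable fun y : ℝ ↦ Complex.Gamma (c + y * I) := by
  have hpi : 0 < π / 2 := by positivity
  have hdom : Integrable fun y : ℝ ↦ (16 * π ^ 2 * (1 + |y|) ^ (3 / 2 : ℝ) +
      Real.Gamma c * Real.exp (π / 2)) * Real.exp (-(π / 2 * |y|)) := by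
    have h1 := (integrable_one_add_abs_rpow_mul_exp_neg hpi (by norm_num : (0 : ℝ) ≤ 3 / 2)).const_mul
      (16 * π ^ 2)
    have h2 := (integrable_exp_neg_mul_abs hpi).const_mul (Real.Gamma c * Real.exp (π / 2))
    refine (h1.add h2).congr (Filter.Eventually.of_forall fun y ↦ ?_)
    simp only [Pi.add_apply]; ring
  -- continuity of `y ↦ Γ(c + iy)` (`Γ` is holomorphic on `re s > 0`; cf. the tree's
  -- `Literature.NumberTheory.LFunctions.ZetaM4.continuous_Gamma_line_pos`, not imported here)
  have hcont : Continuous fun y : ℝ ↦ Complex.Gamma (c + y * I) := by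
    refine continuous_iff_continuousAt.2 fun y ↦ ?_
    have hΓ : DifferentiableAt ℂ Complex.Gamma ((c : ℂ) + y * I) := by
      refine Complex.differentiableAt_Gamma _ fun m h ↦ ?_
      have := congrArg Complex.re h
      simp at this
      linarith [m.cast_nonneg (α := ℝ)]
    have hg : Continuous fun y : ℝ ↦ (c : ℂ) + y * I := by fun_prop
    exact ContinuousAt.comp (f := fun y : ℝ ↦ (c : ℂ) + y * I) hΓ.continuousAt hg.continuousAt
  refine hdom.mono' hcont.aestronglyMeasurable (Filter.Eventually.of_forall fun y ↦ ?_)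
  have he : Real.exp (-(π * |y|) / 2) = Real.exp (-(π / 2 * |y|)) := by congr 1; ring
  rcases le_or_gt 1 |y| with hy | hy
  · calc ‖Complex.Gamma (c + y * I)‖
        ≤ 16 * π ^ 2 * (1 + |y|) ^ (3 / 2 : ℝ) * Real.exp (-(π * |y|) / 2) :=
          norm_Gamma_le_exp_of_le_two hc hc2 hy
      _ ≤ (16 * π ^ 2 * (1 + |y|) ^ (3 / 2 : ℝ) + Real.Gamma c * Real.exp (π / 2)) *
          Real.exp (-(π / 2 * |y|)) := by
          rw [he, add_mul]
          have : 0 ≤ Real.Gamma c * Real.exp (π / 2) * Real.exp (-(π / 2 * |y|)) := by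
            have := Real.Gamma_pos_of_pos hc; positivity
          linarith
  · calc ‖Complex.Gamma (c + y * I)‖ ≤ Real.Gamma c := norm_Gamma_le_Gamma_re hc y
      _ ≤ Real.Gamma c * Real.exp (π / 2) * Real.exp (-(π / 2 * |y|)) := by
          rw [mul_assoc, ← Real.exp_add]
          have hG := Real.Gamma_pos_of_pos hc
          have : 1 ≤ Real.exp (π / 2 + -(π / 2 * |y|)) :=
            Real.one_le_exp (by nlinarith [abs_nonneg y])
          nlinarith
      _ ≤ (16 * π ^ 2 * (1 + |y|) ^ (3 / 2 : ℝ) + Real.Gamma c * Real.exp (π / 2)) *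
          Real.exp (-(π / 2 * |y|)) := by
          rw [add_mul]
          have : 0 ≤ 16 * π ^ 2 * (1 + |y|) ^ (3 / 2 : ℝ) * Real.exp (-(π / 2 * |y|)) := by
            positivity
          linarith

/-- The norm version: `y ↦ ‖Γ(c + iy)‖` is integrable for `0 < c ≤ 2`. [folklore] -/
theorem integrable_norm_Gamma_vertical {c : ℝ} (hc : 0 < c) (hc2 : c ≤ 2) :
    Integrable fun y : ℝ ↦ ‖Complex.Gamma (c + y * I)‖ :=
  (integrable_Gamma_vertical hc hc2).norm

end Literature.Analysis.SpecialFunctions
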